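import Summits.QuantumFields.BalabanUV.T4Continuum.Support.NE7ApeTrivialFlatEnd
import Summits.QuantumFields.BalabanUV.T4Continuum.Support.NE7FlatSkewSlice
import Summits.QuantumFields.BalabanUV.T4Continuum.Support.NE7FlatHkCurlLetter
import Summits.QuantumFields.BalabanUV.T4Continuum.Support.NE7FlatHkOrthogonal
import Summits.QuantumFields.BalabanUV.T4Continuum.Support.NE7ExpansionRemainderFlat
import Summits.QuantumFields.BalabanUV.T4Continuum.Support.NE7TangentTransportRightInv
import Summits.QuantumFields.BalabanUV.T4Continuum.Support.NE7CoarseCurvatureLetter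
import Summits.QuantumFields.BalabanUV.T4Continuum.Support.NE3CpushGaugeCovariance
import Summits.QuantumFields.BalabanUV.T4Continuum.Support.NE3SmoothLiftCurl
import Summits.QuantumFields.BalabanUV.T4Continuum.Support.NE7TanCriticalGauge
import Summits.QuantumFields.BalabanUV.T4Continuum.Support.NE7ConvOneStepWeightedUnique
import Summits.QuantumFields.BalabanUV.T4Continuum.Support.BlockAverageCurrent
import HarnessLib

/-!
# NE7ApeTrivialFlatEndSkew — THE (APE) BOOTSTRAP AT THE TRIVIAL FLAT DATUM, COMPOSED, WITH THE SLICE SOLVER LETTER `G♭` ASKED ON THE SKEW SLICE ONLY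
# (the NE7 pricing desk's RETURN R-END75-ne7ref-1 on F54a `NE7ApeTrivialFlatEnd`: repair R1 + R1b of finding E-62-1 ∕ E-75-4, via p2's `NE7FlatSkewSlice`)

Cell `pub-balaban`, rung (B)+1 sub-cell t4, lineage `b2b-balaban-t4-ne7-p1`, generation 72 (CRUX PROVER NE7 #1); memos H14 (gen 70), H15 (gen 71).  File F55a.
WHY.  F54a `NE7ApeTrivialFlatEnd.smallField_vary_flat_of_trivialLetters` (p390283) displays its slice solver letter as
`hG : ∀ X, IsPeriodicDir X P → dirIter L (k+1) 1 X = 0 → ∀ g ≥ 0, (∀ Y skew periodic tangent, |hess 1 X Y| ≤ g‖Y‖₁) → ‖curl 1 X‖ ≤ K_G·g` over ALL complex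
direction fields `X`.  The NE7 pricing desk (PRICING-NE7 v60 §434 E-62-1, v74 E-75-4; kernel witness `b2b-balaban-t4-ne7-refuter/g62/HGProbe.lean`
`hG_unsatisfiable'`, re-certified on the landed binders in `g75/probe/ENDp390283Vacuity.lean`) shows this binder is UNSATISFIABLE for every `d ≥ 1`: at the flat
background the real Hessian pairing against skew test directions is blind to the Hermitian part of `X` (witness `i·X_w`), so F54a is VACUOUS AS TYPED at its G♭
slot.  The repair (desk menu §435, R1 + R1b) is p2's tree theorem `NE7FlatSkewSlice.smallField_vary_flat_of_flatLetters_skew` (F44's bootstrap with the normal part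
replaced by its skew part, so that the solver letter is asked for SKEW periodic tangent `X` only).  THIS FILE re-issues F54a's two END theorems over it: the proofs
are F54a's verbatim (same lift `A_N := R_H B` by F36∕F37∕F40b∕F44, `ĝ` by F43, `hEXP` by F48b, `hTT` by F53 with the tower letter `Λ` displayed) with the ONE change
that the G♭ binder now reads `∀ X, IsSkewDir X → IsPeriodicDir X P → …` — satisfiable on every finite torus (p2's `NE7FlatSkewSliceSolvable.exists_sliceSolver_flat_skew`),
its `k`-UNIFORM constant `K_G = K·M` being the genuine (1.115)-second-entry content (memo H14 §1 CURRENCY FACT 1), still a HYPOTHESIS here.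
WHAT ([folklore]; 0 def, 0 sorry; dimension `d + 1`).  **`smallField_vary_flat_of_trivialLetters_skew`**: F54a's `smallField_vary_flat_of_trivialLetters` with the
G♭ binder restricted to skew `X` (hypotheses otherwise identical, in the same order: `A` skew `(L^{k+1}N)`-periodic with `‖A‖ ≤ α₀` and lattice differences `≤ α₁`;
class radius `x` (W5∕W6 regime) and plaquette radius `a` of `Ũ = vary 1 A 1`; the σ-line; the TOP NORMALISATION `cavgIter L (k+1) Ũ = 1`; the tower letter
`Λ ≥ 0`; tangent-criticality of `Ũ`; G♭ on the skew slice with constant `K_G`) ⟹ `SmallField Ũ (K_G·(τ + ρ) + c_N + 28α₀²)`, `τ, ρ, c_N` the explicit expressions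
of F54a.  **`smallField_of_trivialLetters_gauge_skew`**: the same pulled back through REP♭'s gauge `u` to the admissible configuration `U` (F39, F26), as F54a's
`smallField_of_trivialLetters_gauge`.  (F54a's theorems are the special cases of these in which the solver letter is granted on all complex `X`.)
HONEST FRAMING (page 1): a composition of tree theorems; REP♭ (incl. the top normalisation), G♭ (now on the skew slice) and the tower letter `Λ` are HYPOTHESES;
ONE datum (the trivial one), not F31's `hape` on the data class; (APE) NOT proved unconditionally; NOT ONE-STEP, NOT NE7; spine 0∕9; finite T⁴ rung (B)+1 — NOT
infinite volume, NOT mass gap, NOT Clay.  Continuum YM on T⁴ ⇐ BetaPertH ∧ nine spine estimates (0/9 proved); BetaPertH ⇐ (D1) ∧ (D4) ∧ CAP+tail; G-an2-4 gates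
asym, D1 and NE2/3/4.
-/

set_option autoImplicit false

open scoped BigOperators Matrix.Norms.L2Operator
open NormedSpace Finset

namespace Summit.QuantumFields.BalabanUV.T4Continuum.NE7ApeTrivialFlatEndSkew

open Literature.MathematicalPhysics.QuantumFieldTheory.Balaban1983to89
open B7Prop1Explicit B7Prop2Explicit MatrixLog UnitaryModel
open T4AveragingDeficitWall (IsUnitaryCfg IsSkewDir SmallField vary curlAt dirL1 flat_mem_classes)
open T4AveragingDeficitWallBoundary (IsPeriodicCfg periodBox)
open AveragingDeficitPeriodicCounting (IsPeriodicDir)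
open AveragingDeficitPlaqDeriv (vary_isUnitaryCfg)
open AveragingDeficitMultiLevelPrep (cavgIter LevelSmall tower)
open AveragingDeficitMultiLevelBridge (tower_eq)
open MinimalActionLevels (perWin)
open BlockAveragePushDirSplit (flat)
open BlockAverageVaryDisc (rho0)
open B4Sect5Proof (latticeConst)
open B5Prop11Plancherel (Tor fine)
open B5Hk163Strip (kappa163)
open B5Hk163Torus (HkOp)
open B5Hk163TorusHolderDecay (CdecD)
open B6LowerBound2153Torus (toT)
open SmoothRefineInterp (interp)
open NE3TangentNoGoWords (dPot)
open NE3TangentFlatStructure (framePot)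
open NE3HessForm (hess dAction)
open NE3TangentCovariantTower (dirIter QbarIter cavgIter_flat)
open NE3ResidualSliceRep (dirIter_sub)
open NE3QbarIterCovLiftPrep (cruxC)
open NE3RightInverseSolveLetters (thetaLoc)
open NE3HatInvCurlLetters (curl1C curl1C_nonneg)
open NE3QuadRemainderTower (vary_add_period)
open NE3SmoothLiftCurl (curlAt_flat_eq)
open NE3CpushGaugeCovariance (dirIter_succ_eq_cpushIter)
open NE7FlatLiftBookkeeping (hkLift_periodic)
open NE7FlatSkewSlice (smallField_vary_flat_of_flatLetters_skew)
open NE7FlatHkCurlLetter (rightInverse_flat_curl_le)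
open NE7FlatHkOrthogonal (hess_flat_hkLift_eq_zero)
open NE7ExpansionRemainderFlat (abs_dAction_vary_sub_hess_flat_le)
open NE7TangentTransportRightInv (hTT_gauge_of_towerLetter)
open NE7TangentTransportGauge (dirIter_skew_periodic)
open NE7CoarseCurvatureLetter (coarseCurl_le levelSmall_zero)
open NE3EnergyShapes (IsUnitarySite)
open BlockAverageCurrent (smallField_gaugeAct)
open NE7ConvOneStepWeightedUnique (smallField_of_gaugeAct_eq)
open NE7TanCriticalGauge (tanCritical_gaugeAct)
open NE7ApeTrivialFlatEnd (tau_currency tau_currency_delta)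

noncomputable section

variable {d : ℕ} {n : Type*} [Fintype n] [DecidableEq n]

/-- **THE (APE) BOOTSTRAP AT THE TRIVIAL FLAT DATUM, COMPOSED, `G♭` ON THE SKEW SLICE** (dimension `d + 1`).  Hypotheses, in order: the representative's
exponent `A` (skew, `(L^{k+1}·N)`-periodic, `‖A‖ ≤ α₀`, lattice differences `≤ α₁`); the class data of `Ũ = vary 1 A 1` (radius `x ≥ 0` with `LevelSmall (d+1) L k x`
in the W5∕W6 regime, plaquette radius `a ≥ 0`); the σ-line of `α̂ = L^{k+1}α₀`; REP♭'s TOP NORMALISATION `cavgIter L (k+1) Ũ = 1`; the straight-tower letter `Λ`;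
tangent-criticality of `Ũ`; G♭ with constant `K_G` on the SKEW periodic tangent space at `1` (binder `IsSkewDir X →` — the desk's R1).  Conclusion:
`SmallField Ũ (K_G·(τ + ρ) + c_N + 28α₀²)` with `τ = a·(curl1C∕(1−θℓ))·M^{d−1}·Λ` (F53), the explicit `ρ` (F48b) and `c_N` (F37 at `g :=` F43's coarse curl bound),
LITERALLY F54a's radius.  Proof: F54a's, with p2's `smallField_vary_flat_of_flatLetters_skew` (R1b: the skew part of `R_H B` keeps EXACT∕CURL∕NORTH) in place of F44. [folklore] -/
theorem smallField_vary_flat_of_trivialLetters_skew [Nonempty n] {L N : ℕ} [NeZero N] (hL : 2 ≤ L) (k : ℕ)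
    {A : Site (d + 1) → Fin (d + 1) → Matrix n n ℂ} (hA : IsSkewDir A) (hAP : IsPeriodicDir A ((L ^ (k + 1) * N : ℕ) : ℤ))
    {α₀ α₁ : ℝ} (hα₀ : 0 ≤ α₀) (hα₁ : 0 ≤ α₁) (hAα : ∀ (y : Site (d + 1)) (κ : Fin (d + 1)), ‖A y κ‖ ≤ α₀)
    (hA1 : ∀ (y : Site (d + 1)) (κ τ : Fin (d + 1)), ‖A (y + e τ) κ - A y κ‖ ≤ α₁)
    {x a : ℝ} (hx : 0 ≤ x) (hs : LevelSmall (d + 1) L k x) (hUx : SmallField (vary (flat (d := d + 1) (n := n)) A 1) x) (ha : 0 ≤ a)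
    (hUa : SmallField (vary (flat (d := d + 1) (n := n)) A 1) a)
    (hθ : cruxC (d + 1) L * (((L : ℝ) ^ (k + 1)) ^ 2 * x) < 1) (hθl : thetaLoc (d + 1) L * (((L : ℝ) ^ (k + 1)) ^ 2 * x) < 1)
    (hε : ((L : ℝ) ^ (k + 1)) ^ 2 * x ≤ 1)
    (hσ : 4 * (3 + 12 * ((d + 1 : ℕ) : ℝ)) ^ 2 * (L : ℝ) ^ (k + 1) * α₀ ≤ rho0 (d + 1) L ^ 2)
    (hflatTop : cavgIter L (k + 1) (vary (flat (d := d + 1) (n := n)) A 1) = flat)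
    {Λ : ℝ} (hΛ0 : 0 ≤ Λ)
    (hΛ : ∀ Y : Site (d + 1) → Fin (d + 1) → Matrix n n ℂ, IsSkewDir Y → IsPeriodicDir Y ((L ^ (k + 1) * N : ℕ) : ℤ) →
      ∑ z ∈ periodBox N, ∑ κ : Fin (d + 1), ‖QbarIter L (k + 1) (vary (flat (d := d + 1) (n := n)) A 1) Y z κ
          - QbarIter L (k + 1) (flat (d := d + 1) (n := n)) Y z κ‖ ≤ Λ * dirL1 Y (periodBox (d := d + 1) (L ^ (k + 1) * N)))
    (hcrit : ∀ Y' : Site (d + 1) → Fin (d + 1) → Matrix n n ℂ, IsSkewDir Y' → IsPeriodicDir Y' ((L ^ (k + 1) * N : ℕ) : ℤ) →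
      dirIter L (k + 1) (vary (flat (d := d + 1) (n := n)) A 1) Y' = 0 →
      dAction (vary (flat (d := d + 1) (n := n)) A 1) Y' (perWin (d + 1) (L ^ (k + 1) * N)) = 0)
    {KG : ℝ}
    (hG : ∀ X : Site (d + 1) → Fin (d + 1) → Matrix n n ℂ, IsSkewDir X → IsPeriodicDir X ((L ^ (k + 1) * N : ℕ) : ℤ) →
      dirIter L (k + 1) (flat (d := d + 1) (n := n)) X = 0 → ∀ g : ℝ, 0 ≤ g →
      (∀ Y : Site (d + 1) → Fin (d + 1) → Matrix n n ℂ, IsSkewDir Y → IsPeriodicDir Y ((L ^ (k + 1) * N : ℕ) : ℤ) →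
        dirIter L (k + 1) (flat (d := d + 1) (n := n)) Y = 0 →
        |hess (flat (d := d + 1) (n := n)) X Y (perWin (d + 1) (L ^ (k + 1) * N))| ≤ g * dirL1 Y (periodBox (d := d + 1) (L ^ (k + 1) * N))) →
      ∀ (z : Site (d + 1)) (μ ν : Fin (d + 1)), μ ≠ ν → ‖curlAt (flat (d := d + 1) (n := n)) X z μ ν‖ ≤ KG * g) :
    SmallField (vary (flat (d := d + 1) (n := n)) A 1)
      (KG * (((a * ((curl1C (d + 1) L / (1 - thetaLoc (d + 1) L * (((L : ℝ) ^ (k + 1)) ^ 2 * x)))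
                  * (((L : ℝ) ^ (k + 1)) ^ (d + 1) / ((L : ℝ) ^ (k + 1)) ^ 2)))
              * Λ)
            + (Fintype.card (T4AveragingDeficitWall.Plane (d + 1)) : ℝ)
              * (2 * (8 * α₀ * (2 * α₁ + 28 * α₀ ^ 2) + 6 * (Real.exp α₀ - 1) * (2 * α₁ + 24 * (Real.exp α₀ - 1) * α₀)
                  + (2 * α₁ + 24 * (Real.exp α₀ - 1) * α₀) * (2 * α₁ + 28 * α₀ ^ 2) + 960 * (Real.exp α₀ - 1) * α₀ ^ 2)
                + 64 * α₀ * α₁))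
        + Fintype.card n * ((2 * (CdecD d * (((d : ℝ) + 1) * (2 * ((d : ℝ) + 1))
              * ((2 + 32 / (kappa163 (d + 1) / (d + 1)) ^ 2) * latticeConst (d + 1) (kappa163 (d + 1) / (d + 1) / 2)))))
              / ((L ^ (k + 1) : ℕ) : ℝ)
            * ((0 + 28 * ((3 + 12 * ((d + 1 : ℕ) : ℝ)) * ((L : ℝ) ^ (k + 1) * α₀)
                    + 4 * (3 + 12 * ((d + 1 : ℕ) : ℝ)) ^ 3 / rho0 (d + 1) L ^ 2 * ((L : ℝ) ^ (k + 1) * α₀) ^ 2) ^ 2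
                  + 4 * (4 * (3 + 12 * ((d + 1 : ℕ) : ℝ)) ^ 3 / rho0 (d + 1) L ^ 2 * ((L : ℝ) ^ (k + 1) * α₀) ^ 2))
                / ((L ^ (k + 1) : ℕ) : ℝ)))
        + 28 * α₀ ^ 2) := by
  classical
  have hL1 : 1 ≤ L := by omega
  haveI : NeZero (L ^ (k + 1)) := ⟨pow_ne_zero _ (by omega)⟩
  have hP1 : 1 ≤ L ^ (k + 1) * N := Nat.one_le_iff_ne_zero.mpr (Nat.mul_ne_zero (pow_ne_zero _ (by omega)) (NeZero.ne N))
  have hmc : N * L ^ (k + 1) = L ^ (k + 1) * N := Nat.mul_comm _ _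
  have htowN : tower L N (k + 1) = L ^ (k + 1) * N := by rw [tower_eq, hmc]
  have htow : ((tower L N (k + 1) : ℕ) : ℤ) = ((L ^ (k + 1) * N : ℕ) : ℤ) := by rw [htowN]
  -- the flat reference and the representative
  have hflatU : IsUnitaryCfg (flat (d := d + 1) (n := n)) := (flat_mem_classes (d := d + 1) (n := n) le_rfl).1
  have hflat0 : SmallField (flat (d := d + 1) (n := n)) 0 := (flat_mem_classes (d := d + 1) (n := n) le_rfl).2
  have hflatP : IsPeriodicCfg (flat (d := d + 1) (n := n)) ((L ^ (k + 1) * N : ℕ) : ℤ) := fun _ _ _ => rfl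
  have hUu : IsUnitaryCfg (vary (flat (d := d + 1) (n := n)) A 1) := vary_isUnitaryCfg hflatU hA 1
  have hUP : IsPeriodicCfg (vary (flat (d := d + 1) (n := n)) A 1) ((L ^ (k + 1) * N : ℕ) : ℤ) := vary_add_period hflatP hAP 1
  -- the coarse datum `φ = D_1 A`: `N`-periodic, with F43's curl bound `ĝ`
  have hs0 : LevelSmall (d + 1) L k 0 := levelSmall_zero L k
  have hAPt : IsPeriodicDir A ((tower L N (k + 1) : ℕ) : ℤ) := by rw [htow]; exact hAP
  have hflatPt : IsPeriodicCfg (flat (d := d + 1) (n := n)) ((tower L N (k + 1) : ℕ) : ℤ) := fun _ _ _ => rfl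
  obtain ⟨-, hφP⟩ := dirIter_skew_periodic (M := N) hL1 k hflatU hflatPt le_rfl hs0 hflat0 hA hAPt
  have hF0 : SmallField (cavgIter L (k + 1) (flat (d := d + 1) (n := n))) 0 := by rw [cavgIter_flat]; exact hflat0
  have hD : SmallField (cavgIter L (k + 1) (vary (flat (d := d + 1) (n := n)) A 1)) 0 := by rw [hflatTop]; exact hflat0
  have hgnn : 0 ≤ (0 + 28 * ((3 + 12 * ((d + 1 : ℕ) : ℝ)) * ((L : ℝ) ^ (k + 1) * α₀)
        + 4 * (3 + 12 * ((d + 1 : ℕ) : ℝ)) ^ 3 / rho0 (d + 1) L ^ 2 * ((L : ℝ) ^ (k + 1) * α₀) ^ 2) ^ 2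
      + 4 * (4 * (3 + 12 * ((d + 1 : ℕ) : ℝ)) ^ 3 / rho0 (d + 1) L ^ 2 * ((L : ℝ) ^ (k + 1) * α₀) ^ 2)) := by positivity
  have hĝ : ∀ (y : Site (d + 1)) (μ ν : Fin (d + 1)), ‖curlAt (flat (d := d + 1) (n := n)) (dirIter L (k + 1) (flat (d := d + 1) (n := n)) A) y μ ν‖
      ≤ 0 + 28 * ((3 + 12 * ((d + 1 : ℕ) : ℝ)) * ((L : ℝ) ^ (k + 1) * α₀)
            + 4 * (3 + 12 * ((d + 1 : ℕ) : ℝ)) ^ 3 / rho0 (d + 1) L ^ 2 * ((L : ℝ) ^ (k + 1) * α₀) ^ 2) ^ 2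
          + 4 * (4 * (3 + 12 * ((d + 1 : ℕ) : ℝ)) ^ 3 / rho0 (d + 1) L ^ 2 * ((L : ℝ) ^ (k + 1) * α₀) ^ 2) := by
    intro y μ ν
    by_cases hμν : μ = ν
    · subst hμν
      rw [curlAt_flat_eq, sub_self, norm_zero]
      exact hgnn
    · have h := coarseCurl_le hL k hflatU hflatP hflat0 hF0 hA hAP hα₀ hAα hσ hD y hμν
      rwa [cavgIter_flat] at h
  -- the flat normal part `A_N = R_H B` (F36∕F37): EXACT + curl letter `c_N`; NORTH (F40b); periodic (F44)
  obtain ⟨hexact, hN7all⟩ := rightInverse_flat_curl_le (n := n) hL1 k N (dirIter L (k + 1) (flat (d := d + 1) (n := n)) A) hφP hĝ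
  have hNexact := hexact
  rw [← dirIter_succ_eq_cpushIter L k] at hNexact
  have hNP := hkLift_periodic (d := d + 1) (n := n) hL1 k N
    (fun p : Tor (fun _ : Fin (d + 1) => N) × Fin (d + 1) => (((L ^ (k + 1) : ℕ) : ℂ))⁻¹
      • dirIter L (k + 1) (flat (d := d + 1) (n := n)) A (B6LowerBound2153Torus.rep (fun _ : Fin (d + 1) => N) p.1) p.2)
  refine smallField_vary_flat_of_flatLetters_skew hL1 k hA hAP hAα hNP hNexact (fun z μ ν _ => hN7all z μ ν) ?_
    hG ?_ (fun Y hY hYP => abs_dAction_vary_sub_hess_flat_le hP1 hA hAP hα₀ hα₁ hAα hA1 hY hYP) hcrit ?_ ?_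
  · -- hNorth (F40b)
    intro Y hY hYP hYT
    rw [dirIter_succ_eq_cpushIter] at hYT
    exact hess_flat_hkLift_eq_zero hL1 k
      (fun p : Tor (fun _ : Fin (d + 1) => N) × Fin (d + 1) => (((L ^ (k + 1) : ℕ) : ℂ))⁻¹
        • dirIter L (k + 1) (flat (d := d + 1) (n := n)) A (B6LowerBound2153Torus.rep (fun _ : Fin (d + 1) => N) p.1) p.2) hY hYP hYT
  · -- 0 ≤ ρ
    have hδ : 0 ≤ Real.exp α₀ - 1 := by linarith [Real.add_one_le_exp α₀]
    positivity
  · -- 0 ≤ τ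
    have hpos : 0 < 1 - thetaLoc (d + 1) L * (((L : ℝ) ^ (k + 1)) ^ 2 * x) := by linarith
    have := curl1C_nonneg (d + 1) L
    positivity
  · -- hTT (F53, with the tower letter `Λ` as displayed)
    have hΛ' : ∀ Y : Site (d + 1) → Fin (d + 1) → Matrix n n ℂ, IsSkewDir Y → IsPeriodicDir Y ((N * L ^ (k + 1) : ℕ) : ℤ) →
        ∑ z ∈ periodBox N, ∑ κ : Fin (d + 1), ‖QbarIter L (k + 1) (vary (flat (d := d + 1) (n := n)) A 1) Y z κ
            - QbarIter L (k + 1) (flat (d := d + 1) (n := n)) Y z κ‖ ≤ Λ * dirL1 Y (periodBox (d := d + 1) (N * L ^ (k + 1))) := by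
      intro Y hY hYP
      rw [hmc] at hYP ⊢
      exact hΛ Y hY hYP
    have hUP' : IsPeriodicCfg (vary (flat (d := d + 1) (n := n)) A 1) ((N * L ^ (k + 1) : ℕ) : ℤ) := by rw [hmc]; exact hUP
    have hTT := hTT_gauge_of_towerLetter hL k hUu hUP' hx hs hUx hθ hθl hε ha hUa hflatTop hΛ'
    intro Y hY hYP hYT
    have hYP' : IsPeriodicDir Y ((N * L ^ (k + 1) : ℕ) : ℤ) := by rw [hmc]; exact hYP
    obtain ⟨Y', hY's, hY'P, hY'T, hY'd⟩ := hTT Y hY hYP' hYT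
    refine ⟨Y', hY's, by rw [← hmc]; exact hY'P, hY'T, ?_⟩
    rw [hmc] at hY'd
    exact hY'd


/-- **THE SAME, PULLED BACK THROUGH THE GAUGE TO THE ADMISSIBLE CONFIGURATION `U`** (`U^u = e^{A}` — REP♭'s gauge `u` unitary and
`(L^{k+1}·N)`-periodic; the class radius `x`, the plaquette radius `a` and tangent-criticality are asked of `U` and transported to the representative by
`smallField_gaugeAct` and F39 `tanCritical_gaugeAct`; the conclusion comes back by F26 `smallField_of_gaugeAct_eq`); G♭ on the SKEW slice. [folklore] -/
theorem smallField_of_trivialLetters_gauge_skew [Nonempty n] {L N : ℕ} [NeZero N] (hL : 2 ≤ L) (k : ℕ)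
    {U : Site (d + 1) → Fin (d + 1) → (Matrix n n ℂ)ˣ} (hU : IsUnitaryCfg U) {x a : ℝ} (hx : 0 ≤ x) (hs : LevelSmall (d + 1) L k x)
    (hUx : SmallField U x) (ha : 0 ≤ a) (hUa : SmallField U a)
    (hcritU : ∀ φ : Site (d + 1) → Fin (d + 1) → Matrix n n ℂ, IsSkewDir φ → IsPeriodicDir φ ((L ^ (k + 1) * N : ℕ) : ℤ) →
      dirIter L (k + 1) U φ = 0 → dAction U φ (perWin (d + 1) (L ^ (k + 1) * N)) = 0)
    {u : Site (d + 1) → (Matrix n n ℂ)ˣ} (hu : IsUnitarySite u) (huP : ∀ (y : Site (d + 1)) (i : Fin (d + 1)), u (y + (((L ^ (k + 1) * N : ℕ) : ℤ)) • e i) = u y)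
    {A : Site (d + 1) → Fin (d + 1) → Matrix n n ℂ} (hgauge : gaugeAct u U = vary (flat (d := d + 1) (n := n)) A 1)
    (hA : IsSkewDir A) (hAP : IsPeriodicDir A ((L ^ (k + 1) * N : ℕ) : ℤ))
    {α₀ α₁ : ℝ} (hα₀ : 0 ≤ α₀) (hα₁ : 0 ≤ α₁) (hAα : ∀ (y : Site (d + 1)) (κ : Fin (d + 1)), ‖A y κ‖ ≤ α₀)
    (hA1 : ∀ (y : Site (d + 1)) (κ τ : Fin (d + 1)), ‖A (y + e τ) κ - A y κ‖ ≤ α₁)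
    (hθ : cruxC (d + 1) L * (((L : ℝ) ^ (k + 1)) ^ 2 * x) < 1) (hθl : thetaLoc (d + 1) L * (((L : ℝ) ^ (k + 1)) ^ 2 * x) < 1)
    (hε : ((L : ℝ) ^ (k + 1)) ^ 2 * x ≤ 1)
    (hσ : 4 * (3 + 12 * ((d + 1 : ℕ) : ℝ)) ^ 2 * (L : ℝ) ^ (k + 1) * α₀ ≤ rho0 (d + 1) L ^ 2)
    (hflatTop : cavgIter L (k + 1) (vary (flat (d := d + 1) (n := n)) A 1) = flat)
    {Λ : ℝ} (hΛ0 : 0 ≤ Λ)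
    (hΛ : ∀ Y : Site (d + 1) → Fin (d + 1) → Matrix n n ℂ, IsSkewDir Y → IsPeriodicDir Y ((L ^ (k + 1) * N : ℕ) : ℤ) →
      ∑ z ∈ periodBox N, ∑ κ : Fin (d + 1), ‖QbarIter L (k + 1) (vary (flat (d := d + 1) (n := n)) A 1) Y z κ
          - QbarIter L (k + 1) (flat (d := d + 1) (n := n)) Y z κ‖ ≤ Λ * dirL1 Y (periodBox (d := d + 1) (L ^ (k + 1) * N)))
    {KG : ℝ}
    (hG : ∀ X : Site (d + 1) → Fin (d + 1) → Matrix n n ℂ, IsSkewDir X → IsPeriodicDir X ((L ^ (k + 1) * N : ℕ) : ℤ) →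
      dirIter L (k + 1) (flat (d := d + 1) (n := n)) X = 0 → ∀ g : ℝ, 0 ≤ g →
      (∀ Y : Site (d + 1) → Fin (d + 1) → Matrix n n ℂ, IsSkewDir Y → IsPeriodicDir Y ((L ^ (k + 1) * N : ℕ) : ℤ) →
        dirIter L (k + 1) (flat (d := d + 1) (n := n)) Y = 0 →
        |hess (flat (d := d + 1) (n := n)) X Y (perWin (d + 1) (L ^ (k + 1) * N))| ≤ g * dirL1 Y (periodBox (d := d + 1) (L ^ (k + 1) * N))) →
      ∀ (z : Site (d + 1)) (μ ν : Fin (d + 1)), μ ≠ ν → ‖curlAt (flat (d := d + 1) (n := n)) X z μ ν‖ ≤ KG * g) :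
    SmallField U
      (KG * (((a * ((curl1C (d + 1) L / (1 - thetaLoc (d + 1) L * (((L : ℝ) ^ (k + 1)) ^ 2 * x)))
                  * (((L : ℝ) ^ (k + 1)) ^ (d + 1) / ((L : ℝ) ^ (k + 1)) ^ 2)))
              * Λ)
            + (Fintype.card (T4AveragingDeficitWall.Plane (d + 1)) : ℝ)
              * (2 * (8 * α₀ * (2 * α₁ + 28 * α₀ ^ 2) + 6 * (Real.exp α₀ - 1) * (2 * α₁ + 24 * (Real.exp α₀ - 1) * α₀)
                  + (2 * α₁ + 24 * (Real.exp α₀ - 1) * α₀) * (2 * α₁ + 28 * α₀ ^ 2) + 960 * (Real.exp α₀ - 1) * α₀ ^ 2)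
                + 64 * α₀ * α₁))
        + Fintype.card n * ((2 * (CdecD d * (((d : ℝ) + 1) * (2 * ((d : ℝ) + 1))
              * ((2 + 32 / (kappa163 (d + 1) / (d + 1)) ^ 2) * latticeConst (d + 1) (kappa163 (d + 1) / (d + 1) / 2)))))
              / ((L ^ (k + 1) : ℕ) : ℝ)
            * ((0 + 28 * ((3 + 12 * ((d + 1 : ℕ) : ℝ)) * ((L : ℝ) ^ (k + 1) * α₀)
                    + 4 * (3 + 12 * ((d + 1 : ℕ) : ℝ)) ^ 3 / rho0 (d + 1) L ^ 2 * ((L : ℝ) ^ (k + 1) * α₀) ^ 2) ^ 2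
                  + 4 * (4 * (3 + 12 * ((d + 1 : ℕ) : ℝ)) ^ 3 / rho0 (d + 1) L ^ 2 * ((L : ℝ) ^ (k + 1) * α₀) ^ 2))
                / ((L ^ (k + 1) : ℕ) : ℝ)))
        + 28 * α₀ ^ 2) := by
  have hL1 : 1 ≤ L := by omega
  have hUx' : SmallField (vary (flat (d := d + 1) (n := n)) A 1) x := by rw [← hgauge]; exact smallField_gaugeAct hu hUx
  have hUa' : SmallField (vary (flat (d := d + 1) (n := n)) A 1) a := by rw [← hgauge]; exact smallField_gaugeAct hu hUa
  have hcrit := tanCritical_gaugeAct hL1 k hU hx hs hUx hu huP hcritU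
  rw [hgauge] at hcrit
  exact smallField_of_gaugeAct_eq hu hgauge
    (smallField_vary_flat_of_trivialLetters_skew hL k hA hAP hα₀ hα₁ hAα hA1 hx hs hUx' ha hUa' hθ hθl hε hσ hflatTop hΛ0 hΛ hcrit hG)

end

end Summit.QuantumFields.BalabanUV.T4Continuum.NE7ApeTrivialFlatEndSkew
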